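import Literature.AnabelianGeometry.AbsoluteAnabelian.AbsCuspFacts
import HarnessLib

/-!
# [AbsCusp] Definition 1.1 (ii): the relation `AbsCusp.OuterRel` ("differ by an `H₁`-inner automorphism")
# — INSTANCE FORMS (FACT-LIST row F-0049), PROOF-ONLY

S. Mochizuki, *Absolute anabelian cuspidalizations of proper hyperbolic curves*, J. Math. Kyoto Univ. **47**
(2007) 451–539, Def. 1.1 (ii) p. 10: "two homomorphisms `H' → H` define the same `H₁`-outer homomorphism if
they differ by composition by an `H₁`-inner automorphism" [cite: MochizukiAbsCusp2007, Def 1.1 (ii) p.10].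

PROOF-ONLY companion of `AbsCuspFacts.lean` (cell abc-iut, block F, seat abc-iut-f-020, KEY INST59A; FROZEN
FACT-LIST row F-0049 `AbsCusp.OuterRel`; 0 `def`, 0 `instance`; nothing restated).  The row's declaration is a
RELATION (a definition), not a theorem: its universal closure "any two homomorphisms are `H₁`-conjugate" is false
(abc-iut-f-055, `AbsCuspFactsSchemaRefutations.not_forall_outerRel`: `0, id : ℤ/2 → ℤ/2`), and the tree so far
states only that it is an equivalence relation (`AbsCusp.outerRel_equivalence`, a structure-valued theorem whose
conclusion head is `Equivalence`).  This file supplies the HEAD-MATCHED instance forms the census of conclusion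
heads looks for — exactly the instances Def. 1.1 (ii) is about: every homomorphism is `H₁`-outer-equivalent to
itself, to its composite with conjugation by any `h ∈ H₁`, and to its composite with any `H₁`-inner automorphism
(`AbsCusp.IsInnerBy`); and the relation is monotone in `H₁`.

Elementary group theory; OUR kernel check of OUR typed vocabulary; nothing here bears on [IUTchIII] Cor. 3.12.
-/

namespace Literature.AnabelianGeometry.AbsoluteAnabelian

namespace AbsCusp

universe u v

variable {H : Type u} {H' : Type v} [Group H] [Group H']

/-- **F-0049, instance form (reflexivity):** every homomorphism `f : H' → H` defines the same `H₁`-outer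
homomorphism as itself (conjugate by `1 ∈ H₁`). [cite: MochizukiAbsCusp2007, Def 1.1 (ii) p.10] -/
theorem outerRel_refl (H₁ : Subgroup H) (f : H' →* H) : OuterRel H₁ f f :=
  (outerRel_equivalence H₁).refl f

/-- **F-0049, THE defining instance:** for `h ∈ H₁`, the homomorphisms `f` and `ι_h ∘ f` (`ι_h = h(-)h⁻¹` the
`H₁`-inner automorphism "induced by conjugation by an element of `H₁`") define the same `H₁`-outer homomorphism
`H' → H`. [cite: MochizukiAbsCusp2007, Def 1.1 (ii) p.10] -/
theorem outerRel_conj_comp (H₁ : Subgroup H) (f : H' →* H) {h : H} (hh : h ∈ H₁) :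
    OuterRel H₁ f ((MulAut.conj h).toMonoidHom.comp f) :=
  ⟨h, hh, fun x => by simp [MulAut.conj_apply]⟩

/-- **F-0049, instance form (composition with an `H₁`-inner automorphism):** if `φ` is an `H₁`-inner
automorphism of `H` (`AbsCusp.IsInnerBy H₁ φ`), then `f` and `φ ∘ f` define the same `H₁`-outer homomorphism —
"they differ by composition by an `H₁`-inner automorphism". [cite: MochizukiAbsCusp2007, Def 1.1 (ii) p.10] -/
theorem outerRel_comp_of_isInnerBy (H₁ : Subgroup H) (f : H' →* H) {φ : H ≃* H} (hφ : IsInnerBy H₁ φ) :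
    OuterRel H₁ f (φ.toMonoidHom.comp f) := by
  obtain ⟨h, hh, hφh⟩ := hφ
  exact ⟨h, hh, fun x => by simp [hφh]⟩

/-- **F-0049, instance form (symmetry):** the relation is symmetric (conjugate back by `h⁻¹ ∈ H₁`).
[cite: MochizukiAbsCusp2007, Def 1.1 (ii) p.10] -/
theorem OuterRel.symm {H₁ : Subgroup H} {f g : H' →* H} (hfg : OuterRel H₁ f g) : OuterRel H₁ g f :=
  (outerRel_equivalence H₁).symm hfg

/-- **F-0049, instance form (transitivity).** [cite: MochizukiAbsCusp2007, Def 1.1 (ii) p.10] -/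
theorem OuterRel.trans {H₁ : Subgroup H} {f g k : H' →* H} (hfg : OuterRel H₁ f g) (hgk : OuterRel H₁ g k) :
    OuterRel H₁ f k :=
  (outerRel_equivalence H₁).trans hfg hgk

/-- **F-0049, monotonicity in `H₁`:** homomorphisms defining the same `H₁`-outer homomorphism define the same
`H₂`-outer homomorphism for every `H₂ ⊇ H₁` (in particular the same outer homomorphism, `H₂ = H`).
[cite: MochizukiAbsCusp2007, Def 1.1 (ii) p.10] -/
theorem OuterRel.mono {H₁ H₂ : Subgroup H} (hle : H₁ ≤ H₂) {f g : H' →* H} (hfg : OuterRel H₁ f g) :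
    OuterRel H₂ f g := by
  obtain ⟨h, hh, hfgh⟩ := hfg
  exact ⟨h, hle hh, hfgh⟩

end AbsCusp

end Literature.AnabelianGeometry.AbsoluteAnabelian
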